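import Summits.HubbardSuperconductivity.HubbardSuperconductivity.Theorems.CooperPairDMottWalkCooperPairDMottPairTrialCeilingLocality
import Summits.HubbardSuperconductivity.HubbardSuperconductivity.Theorems.CooperPairDMottWalkCooperPairDMottPairTrialCeilingTrialState
import Literature.Computability.AlgebraicComplexity.SubspaceProjection

/-!
# Route `CooperPairDMottWalk`, crux `CooperPairDMott` (stmt-HubbardSuperconductivity-1177):
# the local defect form of a gapped block and its transport to the big volume

Support file for the stub `stub_pairTrialCeiling`. The "best plaquette" step of the pair-ceiling
argument measures how far the dressed parent is, locally, from the plaquette ground space `W`. Linear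
algebra of this step, over the pairing `star ψ ⬝ᵥ φ`:

* `re_form_defect_le_of_gap`: if a Hermitian `Q` acts as the scalar `g` on a subspace `W` and is
  `≥ g + γ` on `W^⊥` (as a form), then for the orthogonal (frame) projection `P = B Bᴴ` onto `W`,
  `γ (‖v‖² − Re⟨v, P v⟩) ≤ Re⟨v, Q v⟩ − g ‖v‖²` for every `v`;
* `re_form_defect_jwEmbed`: such a form inequality is transported along the second quantisation
  `jwEmbed e` of an order embedding (it is the positivity of `Q − g − γ(1 − P)`, and `jwEmbed` is a
  positive unital `*`-homomorphism);
* `frame_proj_eq_sum_vecMulVec`, `exists_col_re_le`: `B Bᴴ = Σ_j |b_j⟩⟨b_j|` over the columns, so a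
  lower bound on `Re⟨Ω, e_*(B Bᴴ) Ω⟩` passes to one column (pigeonhole).

References: H. Tasaki (2020), App. A.2 (projections and gaps in finite dimension); O. Bratteli,
D. W. Robinson II (1997) §5.2.2. All statements are [folklore]; no definition is introduced.
-/

set_option linter.dupNamespace false

noncomputable section

namespace Summit.HubbardSuperconductivity.HubbardSuperconductivity.Theorems.CooperPairDMottWalk

open Matrix Finset Literature.MathematicalPhysics.QuantumLattice
open Literature.Computability.AlgebraicComplexity (frame_proj_mul_self frame_proj_mulVec_mem)
open scoped ComplexOrder MatrixOrder

/-! ### The defect form of a gapped subspace -/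

section Gap

variable {X : Type*} [Fintype X] [DecidableEq X]

omit [DecidableEq X] in
/-- `⟨w, A v⟩ = ⟨Aᴴ w, v⟩`. [folklore] -/
theorem star_dotProduct_mulVec_eq (A : Matrix X X ℂ) (w v : X → ℂ) :
    star w ⬝ᵥ (A *ᵥ v) = star (Aᴴ *ᵥ w) ⬝ᵥ v := by
  rw [ThermodynamicLimit.star_mulVec_dotProduct, conjTranspose_conjTranspose]

omit [DecidableEq X] in
/-- `⟨a, b⟩ = conj ⟨b, a⟩`. [folklore] -/
theorem star_dotProduct_comm' (a b : X → ℂ) : star a ⬝ᵥ b = star (star b ⬝ᵥ a) := by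
  rw [star_dotProduct]

omit [DecidableEq X] in
/-- **The defect form of a gapped subspace.** Let `Q` be Hermitian, act as the scalar `g` on `W`, and
satisfy `(g + γ)‖v‖² ≤ Re⟨v, Qv⟩` for `v ⊥ W`; let `B` be a frame of `W` (columns in `W`, `B Bᴴ`
fixing `W`). Then `γ (‖v‖² − Re⟨v, B Bᴴ v⟩) ≤ Re⟨v, Q v⟩ − g ‖v‖²` for all `v`.
Tasaki (2020) App. A.2. [folklore] -/
theorem re_form_defect_le_of_gap {Q : Matrix X X ℂ} (hQ : Q.IsHermitian) (W : Submodule ℂ (X → ℂ))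
    {g γ : ℝ} (hW : ∀ w ∈ W, Q *ᵥ w = (g : ℂ) • w)
    (hgap : ∀ v, (∀ w ∈ W, star w ⬝ᵥ v = 0) → (g + γ) * (star v ⬝ᵥ v).re ≤ (star v ⬝ᵥ (Q *ᵥ v)).re)
    {k : ℕ} {B : Matrix X (Fin k) ℂ} (hcol : ∀ j, (fun x => B x j) ∈ W)
    (hfix : ∀ w ∈ W, (B * Bᴴ) *ᵥ w = w) (v : X → ℂ) :
    γ * ((star v ⬝ᵥ v).re - (star v ⬝ᵥ ((B * Bᴴ) *ᵥ v)).re) ≤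
      (star v ⬝ᵥ (Q *ᵥ v)).re - g * (star v ⬝ᵥ v).re := by
  set P : Matrix X X ℂ := B * Bᴴ with hP
  have hPh : Pᴴ = P := by rw [hP, conjTranspose_mul, conjTranspose_conjTranspose]
  set v₁ := P *ᵥ v with hv₁
  set v₂ := v - v₁ with hv₂
  have hv₁W : v₁ ∈ W := frame_proj_mulVec_mem hcol v
  have hvsum : v = v₁ + v₂ := by rw [hv₂]; abel
  -- `v₂ ⊥ W`
  have hperp : ∀ w ∈ W, star w ⬝ᵥ v₂ = 0 := by
    intro w hw
    rw [hv₂, dotProduct_sub, hv₁, star_dotProduct_mulVec_eq, hPh, hfix w hw, sub_self]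
  have h12 : star v₁ ⬝ᵥ v₂ = 0 := hperp v₁ hv₁W
  have h21 : star v₂ ⬝ᵥ v₁ = 0 := by rw [star_dotProduct_comm', h12, star_zero]
  have hQv₁ : Q *ᵥ v₁ = (g : ℂ) • v₁ := hW v₁ hv₁W
  -- cross terms with `Q`
  have hc1 : star v₂ ⬝ᵥ (Q *ᵥ v₁) = 0 := by rw [hQv₁, dotProduct_smul, h21, smul_zero]
  have hc2 : star v₁ ⬝ᵥ (Q *ᵥ v₂) = 0 := by
    rw [star_dotProduct_mulVec_eq, hQ.eq, hQv₁, star_smul, smul_dotProduct, h12, smul_zero]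
  -- expansions
  have hQQ : star v ⬝ᵥ (Q *ᵥ v) = (g : ℂ) * (star v₁ ⬝ᵥ v₁) + star v₂ ⬝ᵥ (Q *ᵥ v₂) := by
    conv_lhs => rw [hvsum]
    rw [mulVec_add, star_add, add_dotProduct, dotProduct_add, dotProduct_add, hc1, hc2, hQv₁,
      dotProduct_smul, smul_eq_mul]
    ring
  have hvv : star v ⬝ᵥ v = star v₁ ⬝ᵥ v₁ + star v₂ ⬝ᵥ v₂ := by
    conv_lhs => rw [hvsum]
    rw [star_add, add_dotProduct, dotProduct_add, dotProduct_add, h12, h21]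
    ring
  have hvP : star v ⬝ᵥ (P *ᵥ v) = star v₁ ⬝ᵥ v₁ := by
    rw [← hv₁]
    conv_lhs => rw [hvsum]
    rw [star_add, add_dotProduct, h21, add_zero]
  have hgap₂ := hgap v₂ hperp
  rw [hQQ, hvv, hvP, Complex.add_re, Complex.add_re, Complex.re_ofReal_mul]
  nlinarith [hgap₂, ThermodynamicLimit.star_dotProduct_self_eq_re v₁]

end Gap

/-! ### Transport of a defect form along `jwEmbed` -/

section Transport

variable {ι ι' : Type*} [LinearOrder ι] [Fintype ι] [LinearOrder ι'] [Fintype ι'] (e : ι ↪o ι')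

/-- A Hermitian matrix whose form has nonnegative real part is positive semidefinite. [folklore] -/
theorem posSemidef_of_re_nonneg {n : Type*} [Fintype n] {M : Matrix n n ℂ} (hM : M.IsHermitian)
    (h : ∀ v, 0 ≤ (star v ⬝ᵥ (M *ᵥ v)).re) : M.PosSemidef := by
  refine Matrix.PosSemidef.of_dotProduct_mulVec_nonneg hM fun v => ?_
  have him : (star v ⬝ᵥ (M *ᵥ v)).im = 0 := hM.im_star_dotProduct_mulVec_self v
  exact Complex.nonneg_iff.2 ⟨h v, him.symm⟩

/-- **Transport of a defect form along second quantisation.** If Hermitian `Q, P` on the small Fock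
space satisfy `γ (‖v‖² − Re⟨v, P v⟩) ≤ Re⟨v, Q v⟩ − g ‖v‖²` for all `v`, then the same inequality holds
for `e_* Q`, `e_* P` and all vectors of the big Fock space (`e_*` preserves positivity of
`Q − g − γ(1 − P)`). [cite: BratteliRobinsonII1997, §5.2.2] -/
theorem re_form_defect_jwEmbed {Q P : Matrix (Finset ι) (Finset ι) ℂ} (hQ : Q.IsHermitian)
    (hP : P.IsHermitian) {γ g : ℝ}
    (h : ∀ v, γ * ((star v ⬝ᵥ v).re - (star v ⬝ᵥ (P *ᵥ v)).re) ≤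
      (star v ⬝ᵥ (Q *ᵥ v)).re - g * (star v ⬝ᵥ v).re)
    (V : Finset ι' → ℂ) :
    γ * ((star V ⬝ᵥ V).re - (star V ⬝ᵥ (jwEmbed e P *ᵥ V)).re) ≤
      (star V ⬝ᵥ (jwEmbed e Q *ᵥ V)).re - g * (star V ⬝ᵥ V).re := by
  set M : Matrix (Finset ι) (Finset ι) ℂ := Q - (g : ℂ) • 1 - (γ : ℂ) • (1 - P) with hM
  have hMh : M.IsHermitian := by
    have h1 : (1 : Matrix (Finset ι) (Finset ι) ℂ).IsHermitian := isHermitian_one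
    have hg : ((g : ℂ) • (1 : Matrix (Finset ι) (Finset ι) ℂ)).IsHermitian :=
      h1.smul (by rw [isSelfAdjoint_iff, Complex.star_def, Complex.conj_ofReal])
    have hγ : ((γ : ℂ) • ((1 : Matrix (Finset ι) (Finset ι) ℂ) - P)).IsHermitian :=
      (h1.sub hP).smul (by rw [isSelfAdjoint_iff, Complex.star_def, Complex.conj_ofReal])
    exact (hQ.sub hg).sub hγ
  have hMform : ∀ v, (star v ⬝ᵥ (M *ᵥ v)).re =
      (star v ⬝ᵥ (Q *ᵥ v)).re - g * (star v ⬝ᵥ v).re -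
        γ * ((star v ⬝ᵥ v).re - (star v ⬝ᵥ (P *ᵥ v)).re) := by
    intro v
    rw [hM, sub_mulVec, sub_mulVec, smul_mulVec, smul_mulVec, sub_mulVec, one_mulVec, dotProduct_sub,
      dotProduct_sub, dotProduct_smul, dotProduct_smul, dotProduct_sub, smul_eq_mul, smul_eq_mul,
      Complex.sub_re, Complex.sub_re, Complex.re_ofReal_mul, Complex.re_ofReal_mul, Complex.sub_re]
  have hMpsd : M.PosSemidef := posSemidef_of_re_nonneg hMh fun v => by
    rw [hMform]; linarith [h v]
  have hEM : (jwEmbed e M).PosSemidef := posSemidef_jwEmbed e hMpsd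
  have h0 := hEM.dotProduct_mulVec_nonneg V
  have hexp : jwEmbed e M = jwEmbed e Q - (g : ℂ) • 1 - (γ : ℂ) • (1 - jwEmbed e P) := by
    rw [hM, map_sub, map_sub, jwEmbed_apply e ((g : ℂ) • 1), JWEmbed.embedFun_smul,
      JWEmbed.embedFun_one, jwEmbed_apply e ((γ : ℂ) • (1 - P)), JWEmbed.embedFun_smul,
      ← jwEmbed_apply, map_sub, map_one]
  rw [hexp, sub_mulVec, sub_mulVec, smul_mulVec, smul_mulVec, sub_mulVec, one_mulVec, dotProduct_sub,
    dotProduct_sub, dotProduct_smul, dotProduct_smul, dotProduct_sub, smul_eq_mul, smul_eq_mul] at h0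
  have h1 := (Complex.nonneg_iff.1 h0).1
  rw [Complex.sub_re, Complex.sub_re, Complex.re_ofReal_mul, Complex.re_ofReal_mul, Complex.sub_re] at h1
  linarith

end Transport

/-! ### Frames: `B Bᴴ = Σ_j |b_j⟩⟨b_j|` and the pigeonhole over columns -/

section Frame

variable {ι ι' : Type*} [LinearOrder ι] [Fintype ι] [LinearOrder ι'] [Fintype ι'] (e : ι ↪o ι')

omit [LinearOrder ι'] [Fintype ι'] in
/-- A frame projection is the sum of the rank-one projections onto its columns. [folklore] -/
theorem frame_proj_eq_sum_vecMulVec {X : Type*} {k : ℕ} (B : Matrix X (Fin k) ℂ) :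
    B * Bᴴ = ∑ j : Fin k, vecMulVec (fun x => B x j) (star fun x => B x j) := by
  ext x y
  rw [Matrix.mul_apply, Matrix.sum_apply]
  refine Finset.sum_congr rfl fun j _ => ?_
  rw [vecMulVec_apply, conjTranspose_apply, Pi.star_apply]

/-- **Pigeonhole over the columns of a frame**: if `c ≤ Re⟨Ω, e_*(B Bᴴ) Ω⟩` and `k ≥ 1`, some column
`b_j` has `c / k ≤ Re⟨Ω, e_*(|b_j⟩⟨b_j|) Ω⟩`. [folklore] -/
theorem exists_col_re_le {k : ℕ} (hk : 0 < k) (B : Matrix (Finset ι) (Fin k) ℂ) (Ω : Finset ι' → ℂ) {c : ℝ}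
    (h : c ≤ (star Ω ⬝ᵥ (jwEmbed e (B * Bᴴ) *ᵥ Ω)).re) :
    ∃ j : Fin k, c / k ≤ (star Ω ⬝ᵥ (jwEmbed e (vecMulVec (fun x => B x j) (star fun x => B x j)) *ᵥ Ω)).re := by
  have hsum : (star Ω ⬝ᵥ (jwEmbed e (B * Bᴴ) *ᵥ Ω)).re =
      ∑ j : Fin k, (star Ω ⬝ᵥ (jwEmbed e (vecMulVec (fun x => B x j) (star fun x => B x j)) *ᵥ Ω)).re := by
    rw [frame_proj_eq_sum_vecMulVec, map_sum, sum_mulVec, dotProduct_sum, Complex.re_sum]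
  have hne : (Finset.univ : Finset (Fin k)).Nonempty := ⟨⟨0, hk⟩, Finset.mem_univ _⟩
  have hk' : (0 : ℝ) < k := by exact_mod_cast hk
  obtain ⟨j, -, hj⟩ := Finset.exists_le_of_sum_le hne (f := fun _ : Fin k => c / k)
    (g := fun j => (star Ω ⬝ᵥ (jwEmbed e (vecMulVec (fun x => B x j) (star fun x => B x j)) *ᵥ Ω)).re)
    (by
      rw [Finset.sum_const, Finset.card_univ, Fintype.card_fin, nsmul_eq_mul, ← hsum]
      calc (k : ℝ) * (c / k) = c := by field_simp
        _ ≤ _ := h)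
  exact ⟨j, hj⟩

end Frame

/-! ### Registered form -/

/-- **Registered sub-goal `pairTrialCeiling_defectTransport`** (closed form, as registered on the crux
item): a local defect-form inequality `γ(‖v‖² − Re⟨v,Pv⟩) ≤ Re⟨v,Qv⟩ − g‖v‖²` is transported along the
second quantisation of an order embedding. [cite: BratteliRobinsonII1997, §5.2.2] -/
theorem pairTrialCeiling_defectTransport : ∀ {ι ι' : Type} [LinearOrder ι] [Fintype ι] [LinearOrder ι'] [Fintype ι'] (e : ι ↪o ι') {Q P : Matrix (Finset ι) (Finset ι) ℂ}, Q.IsHermitian → P.IsHermitian → ∀ {γ g : ℝ}, (∀ v, γ * ((star v ⬝ᵥ v).re - (star v ⬝ᵥ (P *ᵥ v)).re) ≤ (star v ⬝ᵥ (Q *ᵥ v)).re - g * (star v ⬝ᵥ v).re) → ∀ (V : Finset ι' → ℂ), γ * ((star V ⬝ᵥ V).re - (star V ⬝ᵥ (jwEmbed e P *ᵥ V)).re) ≤ (star V ⬝ᵥ (jwEmbed e Q *ᵥ V)).re - g * (star V ⬝ᵥ V).re :=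
  fun e _ _ hQ hP _ _ h V => re_form_defect_jwEmbed e hQ hP h V

end Summit.HubbardSuperconductivity.HubbardSuperconductivity.Theorems.CooperPairDMottWalk

end
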